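import Mathlib
import HarnessLib
import Summits.CriticalPhenomena.PercolationContinuityZ3.Theorems.PercNearOneGluingNoHeavyLowerTailKnQuestion8AntitheticOrbitColumn

/-!
# `NoHeavyLowerTail` (crux stmt-CriticalPhenomena-4575), antithetic vdBHK programme: assembling AK-ORBIT columns inside pair lemmas

Support file (seat `prim-ineq-gen-7` gen 41; `--supports stmt-CriticalPhenomena-4575`).  Nothing is asserted about the crux; no `sorry`,
no definitions.  Memo: run/shared/lean/prim/prim-ineq-gen-7/FINDING-AKORB-g41.md §1.

An AK-ORBIT certificate (memo §1–§3) bounds a pair functional `φ(L_y, L_yᶜ) + φ(L_yᶜ, L_y)` below by a nonnegative combination of column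
SUMMANDS.  For an orbit `O` (a finite preorder with an antitone involution `j` pairing every element with a comparable partner) and literal
families `X, X′, Y, Y′ : O → Finset (Finset α)` (monotone in `r`, each an upper family in `y`; the position maps `σ, σ′` antitone) the summand is
  `κ_O(y) = Σ_{r∈O} u_r(y) d_{jr}(yᶜ·) + u_r(yᶜ·) d_{jr}(y) − u_r(y) d_r(y) − u_r(yᶜ·) d_r(yᶜ·)`,
  `u_r(y) = [y ∈ X r ∧ yᶜ ∉ X′ (σ r)]`, `d_r(y) = [y ∉ Y r ∧ yᶜ ∈ Y′ (σ′ r)]` (and the swapped versions with `y ↔ yᶜ`).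
This file proves `Σ_y κ_O(y) ≥ 0` (`orbit_kappa_sum_nonneg`): the two 'swapped' terms are re-indexed by `y ↦ yᶜ`, the sum becomes
`2 · Σ_{(r,y)} u (r,y) · ([d (j r, yᶜ)] − [d (r,y)])`, and `AntitheticOrbitColumn.orbit_column_of_comparable` (the AK inequality of `O × 2^α`)
applies once `u` is shown increasing and `d` decreasing on `O × 2^α` (`lit_up_mono`, `lit_down_anti`).  Missing literals of a template are
encoded by the constant families `univ` / `∅`.  With `AntitheticLevelCube.sum_nonneg_of_pair` this is the whole Lean side of an AK-orbit
certificate: the finite pair lemma (SAT-certified, memo §3) enters as a hypothesis exactly as `hpair` does in `AntitheticLevelCube`.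
-/

namespace Summit.CriticalPhenomena.PercolationContinuityZ3.Theorems

open Finset

namespace AntitheticOrbitAssembly

variable {O : Type*} [Fintype O] [Preorder O] {α : Type*} [Fintype α] [DecidableEq α]

omit [Fintype O] in
/-- The 'up' literal conjunction `u (r,y) = [y ∈ X r ∧ yᶜ ∉ X′ (σ r)]` is increasing on `O × 2^α` when `X, X′` are monotone families of
upper sets and `σ` is antitone. [this work] -/
theorem lit_up_mono (X X' : O → Finset (Finset α)) (σ : O → O)
    (hX : ∀ r r' : O, r ≤ r' → X r ⊆ X r') (hX' : ∀ r r' : O, r ≤ r' → X' r ⊆ X' r')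
    (uX : ∀ r, IsUpperSet (X r : Set (Finset α))) (uX' : ∀ r, IsUpperSet (X' r : Set (Finset α)))
    (hσ : ∀ r r' : O, r ≤ r' → σ r' ≤ σ r) :
    ∀ z z' : O × Finset α, z ≤ z' → (z.2 ∈ X z.1 ∧ z.2ᶜ ∉ X' (σ z.1)) → (z'.2 ∈ X z'.1 ∧ z'.2ᶜ ∉ X' (σ z'.1)) := by
  rintro ⟨r, y⟩ ⟨r', y'⟩ hle ⟨h1, h2⟩
  have hr : r ≤ r' := (Prod.mk_le_mk.1 hle).1
  have hy : y ⊆ y' := (Prod.mk_le_mk.1 hle).2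
  refine ⟨?_, ?_⟩
  · exact uX r' hy (hX r r' hr h1)
  · intro h'
    apply h2
    have h3 : y'ᶜ ∈ X' (σ r) := hX' (σ r') (σ r) (hσ r r' hr) h'
    exact uX' (σ r) (compl_subset_compl.2 hy) h3

omit [Fintype O] in
/-- The 'down' literal conjunction `d (r,y) = [y ∉ Y r ∧ yᶜ ∈ Y′ (σ′ r)]` is decreasing on `O × 2^α`. [this work] -/
theorem lit_down_anti (Y Y' : O → Finset (Finset α)) (σ' : O → O)
    (hY : ∀ r r' : O, r ≤ r' → Y r ⊆ Y r') (hY' : ∀ r r' : O, r ≤ r' → Y' r ⊆ Y' r')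
    (uY : ∀ r, IsUpperSet (Y r : Set (Finset α))) (uY' : ∀ r, IsUpperSet (Y' r : Set (Finset α)))
    (hσ' : ∀ r r' : O, r ≤ r' → σ' r' ≤ σ' r) :
    ∀ z z' : O × Finset α, z ≤ z' → (z'.2 ∉ Y z'.1 ∧ z'.2ᶜ ∈ Y' (σ' z'.1)) → (z.2 ∉ Y z.1 ∧ z.2ᶜ ∈ Y' (σ' z.1)) := by
  rintro ⟨r, y⟩ ⟨r', y'⟩ hle ⟨h1, h2⟩
  have hr : r ≤ r' := (Prod.mk_le_mk.1 hle).1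
  have hy : y ⊆ y' := (Prod.mk_le_mk.1 hle).2
  refine ⟨?_, ?_⟩
  · intro h'
    exact h1 (uY r' hy (hY r r' hr h'))
  · have h3 : y'ᶜ ∈ Y' (σ' r) := hY' (σ' r') (σ' r) (hσ' r r' hr) h2
    exact uY' (σ' r) (compl_subset_compl.2 hy) h3

/-- **The `y`-sum of an orbit-column summand is nonnegative.**  For an orbit `O` whose involution `j` pairs every element with a comparable
partner, literal families as in `lit_up_mono` / `lit_down_anti`:
`0 ≤ Σ_y Σ_{r} ( u_r(y)·d_{jr}ˢ(y) + uˢ_r(y)·d_{jr}(y) − u_r(y)·d_r(y) − uˢ_r(y)·dˢ_r(y) )` where `ˢ` swaps `y ↔ yᶜ`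
(`= 2·K_O`, `K_O ≥ 0` by `AntitheticOrbitColumn.orbit_column_of_comparable`). [this work; memo §1] -/
theorem orbit_kappa_sum_nonneg (j : O ≃ O) (hj : ∀ r, j (j r) = r) (hcomp : ∀ r, r ≤ j r ∨ j r ≤ r)
    (σ σ' : O → O) (hσ : ∀ r r' : O, r ≤ r' → σ r' ≤ σ r) (hσ' : ∀ r r' : O, r ≤ r' → σ' r' ≤ σ' r)
    (X X' Y Y' : O → Finset (Finset α))
    (hX : ∀ r r' : O, r ≤ r' → X r ⊆ X r') (hX' : ∀ r r' : O, r ≤ r' → X' r ⊆ X' r')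
    (hY : ∀ r r' : O, r ≤ r' → Y r ⊆ Y r') (hY' : ∀ r r' : O, r ≤ r' → Y' r ⊆ Y' r')
    (uX : ∀ r, IsUpperSet (X r : Set (Finset α))) (uX' : ∀ r, IsUpperSet (X' r : Set (Finset α)))
    (uY : ∀ r, IsUpperSet (Y r : Set (Finset α))) (uY' : ∀ r, IsUpperSet (Y' r : Set (Finset α))) :
    0 ≤ ∑ y : Finset α, ∑ r : O,
        ((if (y ∈ X r ∧ yᶜ ∉ X' (σ r)) then (1:ℤ) else 0) * (if (yᶜ ∉ Y (j r) ∧ y ∈ Y' (σ' (j r))) then (1:ℤ) else 0)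
       + (if (yᶜ ∈ X r ∧ y ∉ X' (σ r)) then (1:ℤ) else 0) * (if (y ∉ Y (j r) ∧ yᶜ ∈ Y' (σ' (j r))) then (1:ℤ) else 0)
       - (if (y ∈ X r ∧ yᶜ ∉ X' (σ r)) then (1:ℤ) else 0) * (if (y ∉ Y r ∧ yᶜ ∈ Y' (σ' r)) then (1:ℤ) else 0)
       - (if (yᶜ ∈ X r ∧ y ∉ X' (σ r)) then (1:ℤ) else 0) * (if (yᶜ ∉ Y r ∧ y ∈ Y' (σ' r)) then (1:ℤ) else 0)) := by
  -- the four terms as functions of (r, y)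
  set T1 : O → Finset α → ℤ := fun r y =>
    (if (y ∈ X r ∧ yᶜ ∉ X' (σ r)) then (1:ℤ) else 0) * (if (yᶜ ∉ Y (j r) ∧ y ∈ Y' (σ' (j r))) then (1:ℤ) else 0) with hT1
  set T3 : O → Finset α → ℤ := fun r y =>
    (if (y ∈ X r ∧ yᶜ ∉ X' (σ r)) then (1:ℤ) else 0) * (if (y ∉ Y r ∧ yᶜ ∈ Y' (σ' r)) then (1:ℤ) else 0) with hT3
  -- the swapped terms are T1, T3 at yᶜ
  have swap2 : ∀ y : Finset α, ∀ r : O,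
      (if (yᶜ ∈ X r ∧ y ∉ X' (σ r)) then (1:ℤ) else 0) * (if (y ∉ Y (j r) ∧ yᶜ ∈ Y' (σ' (j r))) then (1:ℤ) else 0) = T1 r yᶜ := by
    intro y r; simp only [hT1, compl_compl]
  have swap4 : ∀ y : Finset α, ∀ r : O,
      (if (yᶜ ∈ X r ∧ y ∉ X' (σ r)) then (1:ℤ) else 0) * (if (yᶜ ∉ Y r ∧ y ∈ Y' (σ' r)) then (1:ℤ) else 0) = T3 r yᶜ := by
    intro y r; simp only [hT3, compl_compl]
  have rewr : ∀ y : Finset α, (∑ r : O,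
        ((if (y ∈ X r ∧ yᶜ ∉ X' (σ r)) then (1:ℤ) else 0) * (if (yᶜ ∉ Y (j r) ∧ y ∈ Y' (σ' (j r))) then (1:ℤ) else 0)
       + (if (yᶜ ∈ X r ∧ y ∉ X' (σ r)) then (1:ℤ) else 0) * (if (y ∉ Y (j r) ∧ yᶜ ∈ Y' (σ' (j r))) then (1:ℤ) else 0)
       - (if (y ∈ X r ∧ yᶜ ∉ X' (σ r)) then (1:ℤ) else 0) * (if (y ∉ Y r ∧ yᶜ ∈ Y' (σ' r)) then (1:ℤ) else 0)
       - (if (yᶜ ∈ X r ∧ y ∉ X' (σ r)) then (1:ℤ) else 0) * (if (yᶜ ∉ Y r ∧ y ∈ Y' (σ' r)) then (1:ℤ) else 0)))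
      = (∑ r : O, (T1 r y - T3 r y)) + (∑ r : O, (T1 r yᶜ - T3 r yᶜ)) := by
    intro y
    rw [← Finset.sum_add_distrib]
    refine Finset.sum_congr rfl (fun r _ => ?_)
    rw [swap2 y r, swap4 y r]; simp only [hT1, hT3]; ring
  rw [Finset.sum_congr rfl (fun y _ => rewr y), Finset.sum_add_distrib]
  have hsym : ∑ y : Finset α, (∑ r : O, (T1 r yᶜ - T3 r yᶜ)) = ∑ y : Finset α, (∑ r : O, (T1 r y - T3 r y)) :=
    Function.Bijective.sum_comp (Function.Involutive.bijective (fun y : Finset α => compl_compl y)) (fun y => ∑ r : O, (T1 r y - T3 r y))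
  rw [hsym]
  -- the remaining sum is K_O written over O × 2^α
  have hK := AntitheticOrbitColumn.orbit_column_of_comparable (α := α) j hj hcomp
    (fun z : O × Finset α => z.2 ∈ X z.1 ∧ z.2ᶜ ∉ X' (σ z.1)) (fun z : O × Finset α => z.2 ∉ Y z.1 ∧ z.2ᶜ ∈ Y' (σ' z.1))
    (lit_up_mono X X' σ hX hX' uX uX' hσ) (lit_down_anti Y Y' σ' hY hY' uY uY' hσ')
  have prod_sum : ∑ z : O × Finset α, (if (z.2 ∈ X z.1 ∧ z.2ᶜ ∉ X' (σ z.1)) then (1:ℤ) else 0) *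
        ((if ((j z.1, z.2ᶜ).2 ∉ Y (j z.1, z.2ᶜ).1 ∧ (j z.1, z.2ᶜ).2ᶜ ∈ Y' (σ' (j z.1, z.2ᶜ).1)) then (1:ℤ) else 0)
          - (if (z.2 ∉ Y z.1 ∧ z.2ᶜ ∈ Y' (σ' z.1)) then (1:ℤ) else 0))
      = ∑ y : Finset α, ∑ r : O, (T1 r y - T3 r y) := by
    rw [Fintype.sum_prod_type, Finset.sum_comm]
    refine Finset.sum_congr rfl (fun y _ => Finset.sum_congr rfl (fun r _ => ?_))
    simp only [hT1, hT3, compl_compl]; ring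
  rw [prod_sum] at hK
  linarith

end AntitheticOrbitAssembly

end Summit.CriticalPhenomena.PercolationContinuityZ3.Theorems
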